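import Summits.ResolutionOfSingularities.ResolutionOfSingularities.Theorems.PurelyInseparableDim4ResConeHeavyEntryFrame
import Summits.ResolutionOfSingularities.ResolutionOfSingularities.Theorems.PurelyInseparableDim4ResConeAlternation
import HarnessLib
import HarnessLib.Audit.Tags

/-!
# Purely inseparable four-folds — ENTRY WITHOUT A HIT: the CONE-LETTER DICHOTOMY for a permanent boundary letter, every prime `p`,
# every tame shade (K2(p) lane, RUNG 1 «heavy line E/K/L/assembly ∀ (p, d)», holder ruling g5-1 (2); cell `res-dim4-pi`)

[OURS · counted 0 · cell `res-dim4-pi` · K2(p) lane holder res-dim4-p-12 g5, ruling g5-1 (2) 2026-08-29 09:05:52Z «ENTRY WITHOUT A HIT —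
the CONE-LETTER DICHOTOMY, state level ∀ (p, d, n) + chain dress; the ENTRY question every permanent-letter SCC row of the RUNG-0
exit table asks» · seat res-dim4-p-9 g5, over its own E_gen `…ResConeHeavyEntryFrame` (p709142) and res-dim4-p-12 g2/g3's (I2)
transport `…ResConeAlternation.chain_resVertex_step_inf_hyperplane_eq`.]  Nothing here proves K2(p), K2(7), any TAIL(7, d, e) or
resolution of singularities in dimension ≥ 4 / characteristic `p` — NOT proved.  AI kernel work, weaker than expert review.

A boundary letter `W` of a presented state `s` is a **CONE LETTER** when `∀ v ∈ resVertex s, v W = 0` (spelled out, no `def`):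
the polar kernel of the residual cone lies in the hyperplane `H_W`, equivalently `x_W` lies in the span of the cone's linear forms.
The ENTRY frame of the Φ-line (`entryFrame_of_transversal`, p709142 §2) needs exactly the negation — a kernel vector transversal to
`W`.  At `(5,3)`/`(5,4)`/`(p, p−1)` that vector is the STEP DIRECTION of a step that HITS the heavy letter; for a letter that is
PERMANENT (never the chart, never translated: res-dim4-p-5 g5's branch (B) of `good_trichotomy`) no step supplies it, and this file
says what can be said instead.
* §1 **`coneLetter_or_entryFrame`** (state level, ∀ (p, d, n)): cone letter, or the entry 6-tuple of `entryFrame_of_transversal`.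
* §2 TRANSPORT on a constant-`(d, e_G)` tail (any `e`, any shade `d : ℕ∞`, no `CharP`): **`coneLetter_of_succ`** — if the step at `k`
  keeps `W` (`j k ≠ W`, `b k W = 0`) and `W` is a cone letter at `k + 1`, it was one at `k` (the kernel at `k` is
  `(resVertex ⊓ H_{j k}) + K·dir`, `dir W = b k W = 0`, and `resVertex (c (k+1)) ⊓ H_{j k} = resVertex (c k) ⊓ H_{j k}` by (I2));
  hence **`transversal_succ_of_transversal`** — FRAMING IS FORWARD-STABLE — and along a permanent stretch
  `transversal_of_le_of_permanent`, `coneLetter_of_le_of_permanent`; `apply_eq_of_permanent` (the weight of `W` is frozen).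
Consequence (no separate theorem): a PERMANENT letter (`∀ k ≥ k₁, j k ≠ W ∧ b k W = 0`) is EITHER a cone letter at every `k ≥ k₁`
OR framed (a transversal kernel vector exists) at every `k` from some `k₂` on — the dichotomy the LIGHT permanent residue
(frozen weight `< p − d`; res-dim4-p-5 g5's `no_tail_of_permanent_heavy_letter` empties the heavy one by the weight ledger) starts
from.  NOT here: any kill of either branch; the Φ-entry of §1 needs `p ≤ r_W + n`, i.e. a heavy letter, so it does not read light ones.
CAVEAT OF RECORD (holder 08:19:54Z): rung-1 generic material of a FUTURE K2(7) campaign — NOT K2(7).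
[cite: CossartJannsenSaito2020, Thm. 3.10 (4), Thm. 9.3, Def. 8.4, Lemma 12.2 (2)] [cite: CossartPiltant2008, §4 p. 11]
bears_on: LADDER-RESOLUTION:D157-DOOR2 (res-dim4-pi · K2(p) · RUNG 1 cone-letter dichotomy).  Supports
stmt-ResolutionOfSingularities-16155 (helper).
-/

set_option linter.dupNamespace false -- mandated namespace of this single-conjunct summit

noncomputable section

namespace Summit.ResolutionOfSingularities.ResolutionOfSingularities.Theorems.PIDim4

namespace ResCone

open MvPolynomial Finset IsLocalRing
open Literature.AlgebraicGeometry.Resolution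
open Literature.AlgebraicGeometry.Resolution.CentreBlowup
open Literature.AlgebraicGeometry.Resolution.Hauser2010
open Literature.AlgebraicGeometry.Resolution.HauserPerlega2019
open Literature.AlgebraicGeometry.Resolution.WeightedOrder
open PointBlowup (additiveSubspace direction)

variable {K : Type} [Field K]

/-! ## 1. State level: cone letter or entry frame -/

section StateLevel

variable {p : ℕ} [CharP K p]

/-- **CONE LETTER OR ENTRY FRAME, ANY PRIME `p`, ANY TAME SHADE** (state level).  For an isolated presented state with
`x^{s.r} ∣ s.F`, `ord₀ s.F = |r| + d`, `d < p`, `e_G = 2` and a boundary letter `W` with `p ≤ r_W + n`, `n ≤ d`: EITHER `W` is a cone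
letter (`∀ v ∈ resVertex s, v W = 0`) OR the entry frame of `entryFrame_of_transversal` exists (`M·L = 1`, `L u₁ = e_W`, y-rows
annihilating `resVertex s`, `pts ≠ ∅`, `d! < δs`, `d·αs ≤ (n−1)·d!` for `(G)`, `G = s.F / x^{s.r}`). [OURS]
[cite: CossartJannsenSaito2020, Def. 8.4, Lemma 12.2 (2)] [cite: CossartPiltant2008, §4 p. 11] -/
theorem coneLetter_or_entryFrame {d n : ℕ} (hdp : d < p) (hnd : n ≤ d) {s : State K} (hiso : IsIsolated p s.F)
    (hrs : ∀ e ∈ s.F.support, s.r ≤ e) (ho : ordZero s.F = ((s.r.degree + d : ℕ) : ℕ∞))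
    (he : Module.finrank K (resVertex s) = 2) {W : Fin 4} (hn : p ≤ s.r W + n) :
    (∀ v ∈ resVertex s, v W = 0) ∨
    ∃ (L : Fin (2 + 2) → Fin 4 → K) (M : Fin 4 → Fin (2 + 2) → K),
      (∀ t u, ∑ i, M t i * L i u = if t = u then 1 else 0) ∧ L (u1 2) = Pi.single W 1 ∧
      (∀ i, i ≠ u1 2 → i ≠ u2 2 → ∀ v ∈ resVertex s, ∑ t, L i t * v t = 0) ∧
      (pts (fun i => algebraMap (MvPolynomial (Fin 4) K) (OriginLocalization K 4) (∑ t, C (L i t) * X t))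
        (Ideal.span {algebraMap (MvPolynomial (Fin 4) K) (OriginLocalization K 4) (s.F.divMonomial s.r)}) d).Nonempty ∧
      Nat.factorial d < deltaS (fun i => algebraMap (MvPolynomial (Fin 4) K) (OriginLocalization K 4)
        (∑ t, C (L i t) * X t)) (Ideal.span {algebraMap (MvPolynomial (Fin 4) K) (OriginLocalization K 4)
          (s.F.divMonomial s.r)}) d ∧
      d * alphaS (fun i => algebraMap (MvPolynomial (Fin 4) K) (OriginLocalization K 4) (∑ t, C (L i t) * X t))
        (Ideal.span {algebraMap (MvPolynomial (Fin 4) K) (OriginLocalization K 4)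
          (s.F.divMonomial s.r)}) d ≤ (n - 1) * Nat.factorial d := by
  by_cases hcone : ∀ v ∈ resVertex s, v W = 0
  · exact Or.inl hcone
  · push Not at hcone
    obtain ⟨w, hwV, hwW⟩ := hcone
    exact Or.inr (entryFrame_of_transversal hdp hnd hiso hrs ho he hn hwV hwW)

end StateLevel

/-! ## 2. Transport along steps that keep the letter (constant `(d, e_G)` tail, any `e_G`, any shade) -/

section Transport

variable {p : ℕ} [Fact p.Prime] [DecidableEq K]

/-- **A CONE LETTER AT `k + 1` WAS A CONE LETTER AT `k`** (backward persistence).  Along a witnessed isolated above-floor `Step0 p`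
chain with `x^{r₀} ∣ F₀`, constant shade and constant `e_G` from `k₀`, let the step at `k ≥ k₀` keep the letter `W` (`j k ≠ W`,
`b k W = 0`).  If every kernel vector at `k + 1` has `W`-coordinate `0`, so does every kernel vector at `k`: write
`v = u + v_{j k} · dir` with `dir = direction (j k) (b k) ∈ resVertex (c k)` (`dir_{j k} = 1`, `dir_W = b k W = 0`); then
`u ∈ resVertex (c k) ⊓ H_{j k} = resVertex (c (k+1)) ⊓ H_{j k}` by (I2) `chain_resVertex_step_inf_hyperplane_eq`. [OURS]
[cite: CossartJannsenSaito2020, Thm. 3.10 (4), Thm. 9.3] -/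
theorem coneLetter_of_succ {c : ℕ → State K} {j : ℕ → Fin 4} {b : ℕ → Fin 4 → K}
    (hc : ∀ k, IsIsolated p (c k).F ∧ Step0 p (c k) (c (k + 1))) (hw : FreeTail.IsWitnessedChain p c j b)
    (hr0 : ∀ e ∈ (c 0).F.support, (c 0).r ≤ e) (hfloor : ∀ k, ordZero (c k).F ≠ p) {k₀ : ℕ} {d : ℕ∞}
    (hshade : ∀ k, k₀ ≤ k → (c k).shade = d) {e : ℕ}
    (he : ∀ k, k₀ ≤ k → Module.finrank K (resVertex (c k)) = e) {k : ℕ} (hk : k₀ ≤ k) {W : Fin 4}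
    (hjW : j k ≠ W) (hbW : b k W = 0) (hcone₁ : ∀ v ∈ resVertex (c (k + 1)), v W = 0) :
    ∀ v ∈ resVertex (c k), v W = 0 := by
  intro v hv
  have hdir : direction (j k) (b k) ∈ resVertex (c k) := chain_direction_mem_resVertex p hc hw hr0 hfloor hshade hk
  have hdirW : direction (j k) (b k) W = 0 := by rw [direction_apply_of_ne (Ne.symm hjW), hbW]
  have hI2 := chain_resVertex_step_inf_hyperplane_eq p hc hw hr0 hfloor hshade he hk
  -- the component of `v` inside `H_{j k}`
  set u : Fin 4 → K := v - v (j k) • direction (j k) (b k) with hu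
  have huV : u ∈ resVertex (c k) := Submodule.sub_mem _ hv (Submodule.smul_mem _ _ hdir)
  have huj : u (j k) = 0 := by
    rw [hu, Pi.sub_apply, Pi.smul_apply, direction_apply_self, smul_eq_mul, mul_one, sub_self]
  have hu₁ : u ∈ resVertex (c (k + 1)) ⊓ hyperplane (j k) := by
    rw [hI2]
    exact Submodule.mem_inf.mpr ⟨huV, mem_hyperplane.mpr huj⟩
  have huW : u W = 0 := hcone₁ u (Submodule.mem_inf.mp hu₁).1
  have hvu : v W = u W + v (j k) * direction (j k) (b k) W := by
    rw [hu, Pi.sub_apply, Pi.smul_apply, smul_eq_mul]; ring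
  rw [hvu, huW, hdirW, mul_zero, add_zero]

/-- **FRAMING IS FORWARD-STABLE**: if the step at `k` keeps `W` and some kernel vector at `k` is transversal to `W`, then some
kernel vector at `k + 1` is (contrapositive of `coneLetter_of_succ`). [OURS] [cite: CossartJannsenSaito2020, Thm. 3.10 (4), Thm. 9.3] -/
theorem transversal_succ_of_transversal {c : ℕ → State K} {j : ℕ → Fin 4} {b : ℕ → Fin 4 → K}
    (hc : ∀ k, IsIsolated p (c k).F ∧ Step0 p (c k) (c (k + 1))) (hw : FreeTail.IsWitnessedChain p c j b)
    (hr0 : ∀ e ∈ (c 0).F.support, (c 0).r ≤ e) (hfloor : ∀ k, ordZero (c k).F ≠ p) {k₀ : ℕ} {d : ℕ∞}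
    (hshade : ∀ k, k₀ ≤ k → (c k).shade = d) {e : ℕ}
    (he : ∀ k, k₀ ≤ k → Module.finrank K (resVertex (c k)) = e) {k : ℕ} (hk : k₀ ≤ k) {W : Fin 4}
    (hjW : j k ≠ W) (hbW : b k W = 0) (htr : ∃ w ∈ resVertex (c k), w W ≠ 0) :
    ∃ w ∈ resVertex (c (k + 1)), w W ≠ 0 := by
  by_contra h
  push Not at h
  obtain ⟨w, hwV, hwW⟩ := htr
  exact hwW (coneLetter_of_succ hc hw hr0 hfloor hshade he hk hjW hbW h w hwV)

/-- **The weight of a permanent letter is frozen**: if `W` is neither the chart letter nor translated at any step `k ≥ k₁` of a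
constant-shade tail, then `r_k W = r_{k₁} W` for all `k ≥ k₁` (boundary law `tail_weights_laws` (2)). [OURS · bookkeeping]
[cite: HauserPerlega2019PRIMS, §2 (transform D' of D)] -/
theorem apply_eq_of_permanent {c : ℕ → State K} {j : ℕ → Fin 4} {b : ℕ → Fin 4 → K}
    (hc : ∀ k, IsIsolated p (c k).F ∧ Step0 p (c k) (c (k + 1))) (hw : FreeTail.IsWitnessedChain p c j b)
    (hr0 : ∀ e ∈ (c 0).F.support, (c 0).r ≤ e) (hfloor : ∀ k, ordZero (c k).F ≠ p) {k₀ d : ℕ}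
    (hshade : ∀ k, k₀ ≤ k → (c k).shade = ((d : ℕ) : ℕ∞)) {k₁ : ℕ} (hk₁ : k₀ ≤ k₁) {W : Fin 4}
    (hperm : ∀ k, k₁ ≤ k → j k ≠ W ∧ b k W = 0) : ∀ k, k₁ ≤ k → (c k).r W = (c k₁).r W := by
  obtain ⟨-, hlaw, -, -, -⟩ := tail_weights_laws hc hw hr0 hfloor hshade
  intro k hk
  induction k, hk using Nat.le_induction with
  | base => rfl
  | succ k hk ih =>
    rw [← ih, hlaw k (by omega), Finsupp.coe_update, Function.update_of_ne (Ne.symm (hperm k hk).1),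
      Finsupp.filter_apply_pos (fun i => b k i = 0) (c k).r (hperm k hk).2]

/-- **Framing persists along a permanent stretch**: if every step `k ≥ k₁` keeps `W` and `W` is framed (a transversal kernel vector
exists) at some `k ≥ k₁`, it is framed at every later `k′`. [OURS] [cite: CossartJannsenSaito2020, Thm. 3.10 (4), Thm. 9.3] -/
theorem transversal_of_le_of_permanent {c : ℕ → State K} {j : ℕ → Fin 4} {b : ℕ → Fin 4 → K}
    (hc : ∀ k, IsIsolated p (c k).F ∧ Step0 p (c k) (c (k + 1))) (hw : FreeTail.IsWitnessedChain p c j b)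
    (hr0 : ∀ e ∈ (c 0).F.support, (c 0).r ≤ e) (hfloor : ∀ k, ordZero (c k).F ≠ p) {k₀ : ℕ} {d : ℕ∞}
    (hshade : ∀ k, k₀ ≤ k → (c k).shade = d) {e : ℕ}
    (he : ∀ k, k₀ ≤ k → Module.finrank K (resVertex (c k)) = e) {k₁ : ℕ} (hk₁ : k₀ ≤ k₁) {W : Fin 4}
    (hperm : ∀ k, k₁ ≤ k → j k ≠ W ∧ b k W = 0) {k k' : ℕ} (hk : k₁ ≤ k) (hkk' : k ≤ k')
    (htr : ∃ w ∈ resVertex (c k), w W ≠ 0) : ∃ w ∈ resVertex (c k'), w W ≠ 0 := by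
  induction k', hkk' using Nat.le_induction with
  | base => exact htr
  | succ k' hk' ih =>
    exact transversal_succ_of_transversal hc hw hr0 hfloor hshade he (by omega) (hperm k' (by omega)).1
      (hperm k' (by omega)).2 ih

/-- **Cone letters propagate backwards along a permanent stretch**: if every step `k ≥ k₁` keeps `W` and `W` is a cone letter at
some `k′ ≥ k`, `k ≥ k₁`, then it is a cone letter at `k`. [OURS] [cite: CossartJannsenSaito2020, Thm. 3.10 (4), Thm. 9.3] -/
theorem coneLetter_of_le_of_permanent {c : ℕ → State K} {j : ℕ → Fin 4} {b : ℕ → Fin 4 → K}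
    (hc : ∀ k, IsIsolated p (c k).F ∧ Step0 p (c k) (c (k + 1))) (hw : FreeTail.IsWitnessedChain p c j b)
    (hr0 : ∀ e ∈ (c 0).F.support, (c 0).r ≤ e) (hfloor : ∀ k, ordZero (c k).F ≠ p) {k₀ : ℕ} {d : ℕ∞}
    (hshade : ∀ k, k₀ ≤ k → (c k).shade = d) {e : ℕ}
    (he : ∀ k, k₀ ≤ k → Module.finrank K (resVertex (c k)) = e) {k₁ : ℕ} (hk₁ : k₀ ≤ k₁) {W : Fin 4}
    (hperm : ∀ k, k₁ ≤ k → j k ≠ W ∧ b k W = 0) {k k' : ℕ} (hk : k₁ ≤ k) (hkk' : k ≤ k')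
    (hcone : ∀ v ∈ resVertex (c k'), v W = 0) : ∀ v ∈ resVertex (c k), v W = 0 := by
  by_contra h
  push Not at h
  obtain ⟨v, hvV, hvW⟩ := h
  obtain ⟨w, hwV, hwW⟩ := transversal_of_le_of_permanent hc hw hr0 hfloor hshade he hk₁ hperm hk hkk' ⟨v, hvV, hvW⟩
  exact hwW (hcone w hwV)

end Transport

end ResCone

end Summit.ResolutionOfSingularities.ResolutionOfSingularities.Theorems.PIDim4

end
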